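import Summits.AtomisticToContinuum.FouriersLaw.Theses.StaticAbelianSqueeze
import Summits.AtomisticToContinuum.FouriersLaw.Theorems.StaticAbelianSqueezeUniformAbelianRegularityOfQuasiAdditivity
import Summits.AtomisticToContinuum.FouriersLaw.Theorems.LatticeLandauDampingAbelThermodynamicLimitAutocorrIntegrableOn
import HarnessLib

/-!
# Post-crossing tails from truncated Green–Kubo quasi-additivity (line `Sketch`, K1 ⇐ TGK3)
(crux `StaticAbelianSqueeze.UniformAbelianRegularity` = (R), item stmt-AtomisticToContinuum-13416; `--supports` file proving the registered
glue stub `stub_postCrossingTailsOfTruncatedGK`; closes nothing)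

For the OPEN pinned anharmonic chain write `c_M(t) = ∫ J·(P_t J) dμ_{M,T}` and `G_M(ξ) = ∫_{(ξ,∞)} c_M` (truncated Green–Kubo tails).

**Theorem (`stub_postCrossingTailsOfTruncatedGK`).** The ν-free physical stub TGK3 of composition B of the line —
`∃ K, δ ∈ (0,1), N₁ ∀ N ≥ 2N₁ ∀ ξ ≥ 0, |∫_{(ξ,∞)} (c_N − c_{⌊N/2⌋} − c_{N−⌊N/2⌋})| ≤ K N^{1−δ}` (`stub_truncatedGKQuasiAdditive`) —
implies the tail stub K1 of composition A (`stub_postCrossingTails`): `∀ c₀ > 0 ∀ ε > 0 ∃ N₀ ∀ N ≥ N₀ ∀ ξ ≥ c₀N, |G_N(ξ)| ≤ εN`.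
So the two compositions are ordered: TGK3 alone sits above K1 (as the twin cut's ST does, p153215), and (R) ⇐ TGK3 (p164485 +
p163567 + p163862) while (R) ⇐ M1 ∧ M2 ∧ K1 (p164462 + p163652).

Proof: the landed halving lemma `regularity_of_halvingDefect` (p163567) applied to the family `S N ν := G_N(1/ν)`: TGK3 is its
halving quasi-additivity uniformly in `ν ∈ (0, 1]` (power defect, absorbed by the power potential `powerPotential_absorbs`), and the
fixed-`N` input `G_N(1/ν) → 0` (`ν ↓ 0`) is the vanishing of the tails of the integrable function `c_N`
(`stub_autocorrIntegrableOn`, p144688; `tendsto_setIntegral_Ioi_atTop`).  The lemma returns ONE `N₀` and `ν₀` with `|G_N(ξ)| ≤ εN`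
for all `ξ > 1/ν₀`, `N ≥ N₀`; since `ξ ≥ c₀N → ∞` this is K1.  No named fact is used; nothing here closes the item.
-/

noncomputable section

namespace Summit.AtomisticToContinuum.FouriersLaw.Theorems.UniformAbelianRegularity.ZeroMeanDyadicSplice

open MeasureTheory Set Filter Topology
open Summit.AtomisticToContinuum.FouriersLaw.Theorems.AbelThermodynamicLimit.SeriesLawAtEveryLaplaceFrequency
  (stub_autocorrIntegrableOn)

/-- The tails `∫_{(ξ,∞)} c` of a function integrable on `(0,∞)` tend to `0` as `ξ → ∞`. [folklore] -/
theorem tendsto_setIntegral_Ioi_atTop {c : ℝ → ℝ} (hc : IntegrableOn c (Ioi 0)) :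
    Tendsto (fun ξ : ℝ => ∫ s in Ioi ξ, c s) atTop (𝓝 0) := by
  have h1 : Tendsto (fun ξ : ℝ => ∫ x in (0:ℝ)..ξ, c x) atTop (𝓝 (∫ x in Ioi (0:ℝ), c x)) :=
    intervalIntegral_tendsto_integral_Ioi 0 hc tendsto_id
  have h2 := (tendsto_const_nhds (x := ∫ x in Ioi (0:ℝ), c x)).sub h1
  rw [sub_self] at h2
  refine h2.congr' ?_
  filter_upwards [eventually_ge_atTop (0:ℝ)] with ξ hξ
  rw [intervalIntegral.integral_of_le hξ, sub_eq_iff_eq_add, add_comm,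
    ← setIntegral_union (Ioc_disjoint_Ioi le_rfl) measurableSet_Ioi (hc.mono_set Ioc_subset_Ioi_self)
      (hc.mono_set (Ioi_subset_Ioi hξ)), Ioc_union_Ioi_eq_Ioi hξ]

/-- **Registered glue stub `stub_postCrossingTailsOfTruncatedGK` of line `Sketch` (crux stmt-AtomisticToContinuum-13416): K1 ⇐ TGK3.**
Truncated Green–Kubo halving quasi-additivity, uniformly in the truncation point, implies the post-crossing signed-tail bound
`|∫_{(ξ,∞)} c_N| ≤ εN` (`ξ ≥ c₀N`, `N ≥ N₀`) — halving down to fixed-size leaves whose tails vanish. [folklore] -/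
theorem stub_postCrossingTailsOfTruncatedGK :
    (∀ ω₂ lam β γ : ℝ, 0 < ω₂ → 0 < lam → 0 < β → 0 < γ → ∀ T : ℝ, 0 < T → ∃ (K δ : ℝ) (N₁ : ℕ), 0 < δ ∧ δ < 1 ∧ ∀ N : ℕ, 2 * N₁ ≤ N → ∀ ξ : ℝ, 0 ≤ ξ → let c : ℕ → ℝ → ℝ := fun M t => ∫ z, (∑ i : Fin M, (Literature.MathematicalPhysics.KineticTheory.HeatConduction.pinnedChain ω₂ lam β γ).bondCurrent M i z) * (∫ y, (∑ i : Fin M, (Literature.MathematicalPhysics.KineticTheory.HeatConduction.pinnedChain ω₂ lam β γ).bondCurrent M i y) ∂((Literature.MathematicalPhysics.KineticTheory.HeatConduction.pinnedChain ω₂ lam β γ).transitionKernel M T T t.toNNReal z)) ∂((Literature.MathematicalPhysics.KineticTheory.HeatConduction.pinnedChain ω₂ lam β γ).gibbsMeasure M T); |∫ s in Set.Ioi ξ, (c N s - c (N / 2) s - c (N - N / 2) s)| ≤ K * (N:ℝ) ^ (1 - δ)) →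
    ∀ ω₂ lam β γ : ℝ, 0 < ω₂ → 0 < lam → 0 < β → 0 < γ → ∀ T : ℝ, 0 < T → ∀ c₀ : ℝ, 0 < c₀ → ∀ ε : ℝ, 0 < ε →
      ∃ N₀ : ℕ, ∀ N : ℕ, N₀ ≤ N → ∀ ξ : ℝ, c₀ * N ≤ ξ → let J : Literature.MathematicalPhysics.KineticTheory.HeatConduction.PhaseSpace N → ℝ := fun z => ∑ i : Fin N, (Literature.MathematicalPhysics.KineticTheory.HeatConduction.pinnedChain ω₂ lam β γ).bondCurrent N i z; |∫ s in Set.Ioi ξ, ∫ z, J z * (∫ y, J y ∂((Literature.MathematicalPhysics.KineticTheory.HeatConduction.pinnedChain ω₂ lam β γ).transitionKernel N T T s.toNNReal z)) ∂((Literature.MathematicalPhysics.KineticTheory.HeatConduction.pinnedChain ω₂ lam β γ).gibbsMeasure N T)| ≤ ε * N := by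
  intro hTGK ω₂ lam β γ hω hl hβ hγ T hT c₀ hc₀ ε hε
  obtain ⟨K, δ, N₁, hδ, hδ1, hQ⟩ := hTGK ω₂ lam β γ hω hl hβ hγ T hT
  set P := Literature.MathematicalPhysics.KineticTheory.HeatConduction.pinnedChain ω₂ lam β γ with hP_def
  set c : ℕ → ℝ → ℝ := fun M t => ∫ z, (∑ i : Fin M, P.bondCurrent M i z) *
      (∫ y, (∑ i : Fin M, P.bondCurrent M i y) ∂(P.transitionKernel M T T t.toNNReal z)) ∂(P.gibbsMeasure M T) with hc_def
  -- the family `S M ν := G_M(1/ν) = ∫_{(1/ν, ∞)} c_M`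
  set G : ℕ → ℝ → ℝ := fun M ν => ∫ s in Ioi ν⁻¹, c M s with hG_def
  have hint : ∀ M : ℕ, IntegrableOn (c M) (Ioi 0) := fun M =>
    stub_autocorrIntegrableOn ω₂ lam β γ hω hl hβ hγ T hT M
  have hK0 : 0 ≤ max K 0 := le_max_right _ _
  obtain ⟨K', hK'0, N₂, hstep'⟩ := powerPotential_absorbs hK0 hδ hδ1
  have key := regularity_of_halvingDefect G (fun N => max K 0 * (N:ℝ) ^ (1 - δ)) (fun N => K' * (N:ℝ) ^ (1 - δ))
    1 (max N₁ N₂) one_pos (fun N => mul_nonneg hK'0 (Real.rpow_nonneg (Nat.cast_nonneg _) _)) ?_ ?_ ?_ ?_ ε hε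
  · obtain ⟨ν₀, hν₀, N₀, hkey⟩ := key
    refine ⟨max N₀ (⌈(ν₀⁻¹ + 1) / c₀⌉₊ + 1), fun N hN ξ hξ => ?_⟩
    have hN₀ : N₀ ≤ N := le_trans (le_max_left _ _) hN
    have hξ1 : ν₀⁻¹ < ξ := by
      have h1 : (ν₀⁻¹ + 1) / c₀ ≤ ⌈(ν₀⁻¹ + 1) / c₀⌉₊ := Nat.le_ceil _
      have h2 : ((⌈(ν₀⁻¹ + 1) / c₀⌉₊ + 1 : ℕ) : ℝ) ≤ N := by
        exact_mod_cast le_trans (le_max_right _ _) hN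
      push_cast at h2
      have h3 : (ν₀⁻¹ + 1) / c₀ * c₀ = ν₀⁻¹ + 1 := div_mul_cancel₀ _ hc₀.ne'
      nlinarith
    have hξ0 : 0 < ξ := lt_trans (inv_pos.2 hν₀) hξ1
    have hν : ξ⁻¹ < ν₀ := by rwa [inv_lt_comm₀ hξ0 hν₀]
    have h := hkey ξ⁻¹ (inv_pos.2 hξ0) hν N hN₀
    have hG : G N ξ⁻¹ = ∫ s in Ioi ξ, c N s := by simp only [hG_def, inv_inv]
    rw [hG] at h
    exact h
  · -- the potential absorbs the defect
    intro N hN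
    have h2 : 2 * N₂ ≤ N := le_trans (Nat.mul_le_mul_left 2 (le_max_right _ _)) hN
    have h := hstep' N h2
    linarith
  · -- sublinearity `K' N^{1−δ} / N → 0`
    have h1 : Tendsto (fun N : ℕ => K' * ((N:ℝ) ^ (-δ))) atTop (𝓝 (K' * 0)) :=
      ((tendsto_rpow_neg_atTop hδ).comp tendsto_natCast_atTop_atTop).const_mul K'
    rw [mul_zero] at h1
    refine h1.congr' ?_
    filter_upwards [eventually_ge_atTop 1] with N hN
    have hN0 : (0:ℝ) < N := by exact_mod_cast hN
    rw [mul_div_assoc, ← Real.rpow_sub_one hN0.ne']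
    congr 2
    ring
  · -- TGK3 at the truncation point `ξ = 1/ν ≥ 0`
    intro N hN ν hν _hν1
    have h1 : 2 * N₁ ≤ N := le_trans (Nat.mul_le_mul_left 2 (le_max_left _ _)) hN
    have hξ : (0:ℝ) ≤ ν⁻¹ := (inv_pos.2 hν).le
    have hq : |∫ s in Ioi ν⁻¹, (c N s - c (N / 2) s - c (N - N / 2) s)| ≤ K * (N:ℝ) ^ (1 - δ) := hQ N h1 ν⁻¹ hξ
    have hi : ∀ M : ℕ, IntegrableOn (c M) (Ioi ν⁻¹) := fun M => (hint M).mono_set (Ioi_subset_Ioi hξ)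
    have hsplit : (∫ s in Ioi ν⁻¹, (c N s - c (N / 2) s - c (N - N / 2) s)) = G N ν - G (N / 2) ν - G (N - N / 2) ν := by
      simp only [hG_def]
      have i1 : Integrable (fun s => c N s - c (N / 2) s) (volume.restrict (Ioi ν⁻¹)) := (hi N).sub (hi (N / 2))
      rw [integral_sub i1 (hi (N - N / 2)), integral_sub (hi N) (hi (N / 2))]
    rw [hsplit] at hq
    exact hq.trans (mul_le_mul_of_nonneg_right (le_max_left _ _) (Real.rpow_nonneg (Nat.cast_nonneg _) _))
  · -- fixed-`N` tails vanish: `G_N(1/ν) → 0` as `ν ↓ 0`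
    intro N
    exact (tendsto_setIntegral_Ioi_atTop (hint N)).comp tendsto_inv_nhdsGT_zero

end Summit.AtomisticToContinuum.FouriersLaw.Theorems.UniformAbelianRegularity.ZeroMeanDyadicSplice

end
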